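import Mathlib
import Summits.KontsevichZagierPeriods.Zeta5Search.RecordRayLevels
import Summits.KontsevichZagierPeriods.Zeta5Search.CollinearityGuardProof
import HarnessLib

/-!
# ζ(5) search — CLASS TYPE COVERS IV: the collinearity rung (census letter O) from a type cover (p3 g6)

HONEST FRAMING: systematic search; no irrationality claim unless certified.  Cell `pub-zeta5`, prover seat p3, generation 6.

The rung-O licence of the tree (`casLB_succ_le_of_ccGuard`: `collinearityCriterion_holds` + census g17's structural guard) reads the
number `ccCount` of orbit types among the live deep classes through `Finset.sort`, which a scale-free window proof cannot evaluate.
This file replaces the COUNT by its meaning: §1 (any `b`) the two line lemmas of `CollinearityGuardProof` restated over RELATEDNESS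
hypotheses — `line_origin_of_related` (all live deep keys pairwise `sameKey`-related ⇒ a line through the origin) and
`line_affine_of_reps` (`N` odd, two live representatives cover all live keys ⇒ an affine line) — proofs verbatim from the tree's
`line_origin_of_ccCount_le_one` / `line_affine_of_ccCount_eq_two` after the first step; §2 the transfer `IsType.levelVec_eq`, the
decidable check `checkO` (regime H0, every live deep type `sameKey` to one of two given keys) and `collinear_of_cover`
(the line, whichever of the two keys are realised); §3 the record-ray wrapper `record_O` (`c ≤ v_p(Cas₇(b(n)))` from a cover,
`checkLB`, `checkO`, the fallback `checkLBx`, `N ≥ 3` odd and the moment range `(N−1)p + 2 ≤ 50n + 3`).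
Valuations of rationals; every kernel exponent these feed stays `< 1` — no irrationality content.
-/

noncomputable section

open Finset

namespace Summit.KontsevichZagierPeriods.Zeta5Search.ClusterValuation

open Summit.KontsevichZagierPeriods.Zeta5Search.DualSeries (InBox)
open Summit.KontsevichZagierPeriods.Zeta5Search.WedgeDictionary (dOf)
open Summit.KontsevichZagierPeriods.Zeta5Search.CasoratianValuation (InPolytope shift casoratian)
open Summit.KontsevichZagierPeriods.Zeta5Search.PadicSeries

variable {p : ℕ} [hp : Fact p.Prime]

/-! ## §1 The two lines from relatedness hypotheses -/

section Orbits

variable (b : ℕ → ℤ) (hb : InPolytope b) (hp5 : 5 ≤ p) (hpb : (p : ℤ) ≤ b 0) (hwin : (b 0 + 2 : ℤ) < (p : ℤ) ^ 2) {N : ℕ}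
include hb hp5 hpb hwin

/-- **All live deep keys related: a line through the origin** (the proof of `line_origin_of_ccCount_le_one` from its second step). -/
theorem line_origin_of_related
    (hrel : ∀ x ∈ ccLive b p N, ∀ y ∈ ccLive b p N,
      sameKey (decide (CentreIn b p y), levelVec b p y) (decide (CentreIn b p x), levelVec b p x) = true) :
    ∃ a c : ℤ, ¬ ((p : ℤ) ∣ a ∧ (p : ℤ) ∣ c) ∧
      ∀ x ∈ deepClasses b p N, pCong p (a * orbitK b p N x + c * orbitV b p N x + ((0 : ℤ) : ℚ)) = true := by
  classical
  have hprime := hp.out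
  have hone : ¬ ((p : ℤ) ∣ 1) := fun h => by have := Int.le_of_dvd one_pos h; omega
  have ev : ∀ z : ZMod p, (((z.val : ℕ) : ℤ) : ZMod p) = z := fun z => by rw [Int.cast_natCast, ZMod.natCast_zmod_val]
  by_cases hlive : ∃ x₀, x₀ ∈ ccLive b p N
  · obtain ⟨x₀, hx₀⟩ := hlive
    have hx₀D : x₀ ∈ deepClasses b p N := (mem_ccLive_iff.1 hx₀).1
    have hall : ∀ x ∈ deepClasses b p N,
        (((orbitK b p N x : ℚ) : ZMod p) = 0 ∧ ((orbitV b p N x : ℚ) : ZMod p) = 0) ∨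
        (((orbitK b p N x : ℚ) : ZMod p) = ((orbitK b p N x₀ : ℚ) : ZMod p) ∧
          ((orbitV b p N x : ℚ) : ZMod p) = ((orbitV b p N x₀ : ℚ) : ZMod p)) ∨
        (((orbitK b p N x : ℚ) : ZMod p) = (-1 : ZMod p) ^ (N + 1) * ((orbitK b p N x₀ : ℚ) : ZMod p) ∧
          ((orbitV b p N x : ℚ) : ZMod p) = (-1 : ZMod p) ^ (N + 1) * ((orbitV b p N x₀ : ℚ) : ZMod p)) := by
      intro x hxD
      by_cases hxl : x ∈ ccLive b p N
      · exact Or.inr (orbit_cast_of_sameKey b hb hp5 hpb hwin hx₀D hxD (hrel x₀ hx₀ x hxl))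
      · exact Or.inl (orbit_cast_eq_zero_of_not_live b hb hp5 hpb hwin hxD hxl)
    by_cases hz : ((orbitK b p N x₀ : ℚ) : ZMod p) = 0 ∧ ((orbitV b p N x₀ : ℚ) : ZMod p) = 0
    · refine ⟨1, 0, fun h => hone h.1, fun x hxD => pCong_line_of_cast b hb hp5 hwin 1 0 0 x ?_⟩
      rcases hall x hxD with ⟨hk, -⟩ | ⟨hk, -⟩ | ⟨hk, -⟩ <;> rw [hk] <;> simp [hz.1]
    · refine ⟨((((orbitV b p N x₀ : ℚ) : ZMod p).val : ℕ) : ℤ), -((((orbitK b p N x₀ : ℚ) : ZMod p).val : ℕ) : ℤ),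
        fun h => hz ?_, fun x hxD => pCong_line_of_cast b hb hp5 hwin _ _ 0 x ?_⟩
      · obtain ⟨h1, h2⟩ := h
        refine ⟨?_, ?_⟩
        · rw [← ev ((orbitK b p N x₀ : ℚ) : ZMod p)]; exact (ZMod.intCast_zmod_eq_zero_iff_dvd _ _).2 ((dvd_neg).1 h2)
        · rw [← ev ((orbitV b p N x₀ : ℚ) : ZMod p)]; exact (ZMod.intCast_zmod_eq_zero_iff_dvd _ _).2 h1
      · rw [Int.cast_neg, ev, ev, Int.cast_zero, add_zero]
        rcases hall x hxD with ⟨hk, hv⟩ | ⟨hk, hv⟩ | ⟨hk, hv⟩ <;> rw [hk, hv] <;> ring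
  · push Not at hlive
    refine ⟨1, 0, fun h => hone h.1, fun x hxD => pCong_line_of_cast b hb hp5 hwin 1 0 0 x ?_⟩
    have hx0 := orbit_cast_eq_zero_of_not_live b hb hp5 hpb hwin hxD (hlive x)
    rw [hx0.1, hx0.2]; simp

/-- **`N` odd, two live representatives covering the live keys: an affine line** (the proof of `line_affine_of_ccCount_eq_two`
from its third step). -/
theorem line_affine_of_reps (hodd : N % 2 = 1) {x₁ x₂ : ℕ} (hx₁ : x₁ ∈ ccLive b p N) (hx₂ : x₂ ∈ ccLive b p N)
    (hcov : ∀ x ∈ ccLive b p N,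
      sameKey (decide (CentreIn b p x), levelVec b p x) (decide (CentreIn b p x₁), levelVec b p x₁) = true ∨
      sameKey (decide (CentreIn b p x), levelVec b p x) (decide (CentreIn b p x₂), levelVec b p x₂) = true) :
    ∃ a c e : ℤ, ¬ ((p : ℤ) ∣ a ∧ (p : ℤ) ∣ c) ∧
      ∀ x ∈ deepClasses b p N, pCong p (a * orbitK b p N x + c * orbitV b p N x + e) = true := by
  classical
  have hprime := hp.out
  have hone : ¬ ((p : ℤ) ∣ 1) := fun h => by have := Int.le_of_dvd one_pos h; omega
  have ev : ∀ z : ZMod p, (((z.val : ℕ) : ℤ) : ZMod p) = z := fun z => by rw [Int.cast_natCast, ZMod.natCast_zmod_val]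
  have hs1 : (-1 : ZMod p) ^ (N + 1) = 1 := Even.neg_one_pow (Nat.odd_iff.2 hodd).add_one
  have hlive : ∀ x ∈ deepClasses b p N, x ∈ ccLive b p N :=
    fun x hxD => mem_ccLive_iff.2 ⟨hxD, fun ⟨_, h2, _⟩ => by omega⟩
  have hx₁D : x₁ ∈ deepClasses b p N := (mem_ccLive_iff.1 hx₁).1
  have hx₂D : x₂ ∈ deepClasses b p N := (mem_ccLive_iff.1 hx₂).1
  obtain ⟨K₁, hK₁⟩ : ∃ K₁, ((orbitK b p N x₁ : ℚ) : ZMod p) = K₁ := ⟨_, rfl⟩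
  obtain ⟨V₁, hV₁⟩ : ∃ V₁, ((orbitV b p N x₁ : ℚ) : ZMod p) = V₁ := ⟨_, rfl⟩
  obtain ⟨K₂, hK₂⟩ : ∃ K₂, ((orbitK b p N x₂ : ℚ) : ZMod p) = K₂ := ⟨_, rfl⟩
  obtain ⟨V₂, hV₂⟩ : ∃ V₂, ((orbitV b p N x₂ : ℚ) : ZMod p) = V₂ := ⟨_, rfl⟩
  have hall : ∀ x ∈ deepClasses b p N,
      (((orbitK b p N x : ℚ) : ZMod p) = K₁ ∧ ((orbitV b p N x : ℚ) : ZMod p) = V₁) ∨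
      (((orbitK b p N x : ℚ) : ZMod p) = K₂ ∧ ((orbitV b p N x : ℚ) : ZMod p) = V₂) := by
    intro x hxD
    rcases hcov x (hlive x hxD) with h | h
    · rcases orbit_cast_of_sameKey b hb hp5 hpb hwin hx₁D hxD h with h' | h'
      · rw [hK₁, hV₁] at h'; exact Or.inl h'
      · rw [hs1, one_mul, one_mul, hK₁, hV₁] at h'; exact Or.inl h'
    · rcases orbit_cast_of_sameKey b hb hp5 hpb hwin hx₂D hxD h with h' | h'
      · rw [hK₂, hV₂] at h'; exact Or.inr h'
      · rw [hs1, one_mul, one_mul, hK₂, hV₂] at h'; exact Or.inr h'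
  by_cases heq : K₁ = K₂ ∧ V₁ = V₂
  · obtain ⟨heK, heV⟩ := heq
    by_cases hz : K₁ = 0 ∧ V₁ = 0
    · refine ⟨1, 0, 0, fun h => hone h.1, fun x hxD => pCong_line_of_cast b hb hp5 hwin 1 0 0 x ?_⟩
      rcases hall x hxD with ⟨hk', -⟩ | ⟨hk', -⟩ <;> rw [hk'] <;> simp [hz.1, ← heK]
    · refine ⟨((V₁.val : ℕ) : ℤ), -((K₁.val : ℕ) : ℤ), 0, fun h => hz ?_, fun x hxD =>
        pCong_line_of_cast b hb hp5 hwin _ _ 0 x ?_⟩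
      · obtain ⟨h1, h2⟩ := h
        refine ⟨?_, ?_⟩
        · rw [← ev K₁]; exact (ZMod.intCast_zmod_eq_zero_iff_dvd _ _).2 ((dvd_neg).1 h2)
        · rw [← ev V₁]; exact (ZMod.intCast_zmod_eq_zero_iff_dvd _ _).2 h1
      · rw [Int.cast_neg, ev, ev, Int.cast_zero, add_zero]
        rcases hall x hxD with ⟨hk', hv'⟩ | ⟨hk', hv'⟩ <;> rw [hk', hv'] <;> [ring; (rw [← heK, ← heV]; ring)]
  · refine ⟨(((V₁ - V₂).val : ℕ) : ℤ), -(((K₁ - K₂).val : ℕ) : ℤ), (((K₁ * V₂ - V₁ * K₂).val : ℕ) : ℤ),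
      fun h => heq ?_, fun x hxD => pCong_line_of_cast b hb hp5 hwin _ _ _ x ?_⟩
    · obtain ⟨h1, h2⟩ := h
      have h1' : V₁ - V₂ = 0 := by rw [← ev (V₁ - V₂)]; exact (ZMod.intCast_zmod_eq_zero_iff_dvd _ _).2 h1
      have h2' : K₁ - K₂ = 0 := by rw [← ev (K₁ - K₂)]; exact (ZMod.intCast_zmod_eq_zero_iff_dvd _ _).2 ((dvd_neg).1 h2)
      exact ⟨sub_eq_zero.1 h2', sub_eq_zero.1 h1'⟩
    · rw [Int.cast_neg, ev, ev, ev]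
      rcases hall x hxD with ⟨hk', hv'⟩ | ⟨hk', hv'⟩ <;> rw [hk', hv'] <;> ring

end Orbits

end Summit.KontsevichZagierPeriods.Zeta5Search.ClusterValuation

namespace Summit.KontsevichZagierPeriods.Zeta5Search.ClassTypeCover

open Summit.KontsevichZagierPeriods.Zeta5Search.ClusterValuation
open Summit.KontsevichZagierPeriods.Zeta5Search.CasoratianValuation (InPolytope shift casoratian)
open Summit.KontsevichZagierPeriods.Zeta5Search.WedgeDictionary (dOf)

variable {p : ℕ}

/-! ## §2 The collinearity hypotheses from a cover -/

/-- **`levelVec = T`** for a typed class. -/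
theorem IsType.levelVec_eq [Fact p.Prime] {b : ℕ → ℤ} {x : ℕ} {T : List ℤ} {cen : Bool} (h : IsType b p x T cen) :
    levelVec b p x = T := by
  rw [← h.expVector_eq, levelVec_level b h.lt h.top h.top', expVector_level b h.lt h.top h.top']

/-- The key of a typed class. -/
theorem IsType.key_eq [Fact p.Prime] {b : ℕ → ℤ} {x : ℕ} {T : List ℤ} {cen : Bool} (h : IsType b p x T cen) :
    (decide (CentreIn b p x), levelVec b p x) = (cen, T) := by
  have hc := h.cen_iff
  rw [h.levelVec_eq]
  cases cen <;> simp_all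

/-- A type is LIVE at depth `N`: not (centre-free, `N` even, palindromic). -/
def liveL (N : ℕ) (T : List ℤ) (cen : Bool) : Bool := !(!cen && (N % 2 == 0) && decide (T = T.reverse))

/-- Check for the collinearity rung at depth `N` with the two candidate keys `K₁`, `K₂`: regime H0 (`−N ≤ E` on every type) and
every live type of exponent `−N` is `sameKey` to `K₁` or to `K₂`. -/
def checkO (odd : Bool) (TY : List (List ℤ × Bool)) (N : ℕ) (K₁ K₂ : Bool × List ℤ) : Bool :=
  TY.all fun tc => decide (-(N : ℤ) ≤ expL odd tc.1 tc.2) &&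
    (!(decide (expL odd tc.1 tc.2 = -(N : ℤ)) && liveL N tc.1 tc.2) ||
      (sameKey (tc.2, tc.1) K₁ || sameKey (tc.2, tc.1) K₂))

/-- From a cover and `checkO`: the key of every live deep class is `sameKey` to `K₁` or to `K₂`. -/
theorem live_key_of_cover [Fact p.Prime] {b : ℕ → ℤ} {TY : List (List ℤ × Bool)} (hcov : Cover b p TY) {N : ℕ}
    {K₁ K₂ : Bool × List ℤ} (hchk : checkO (decide (¬ (2 : ℤ) ∣ b 0)) TY N K₁ K₂ = true) {x : ℕ} (hx : x ∈ ccLive b p N) :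
    sameKey (decide (CentreIn b p x), levelVec b p x) K₁ = true ∨ sameKey (decide (CentreIn b p x), levelVec b p x) K₂ = true := by
  rw [checkO, List.all_eq_true] at hchk
  obtain ⟨hxD, hnot⟩ := mem_ccLive_iff.1 hx
  obtain ⟨hxp, hE⟩ := (mem_deepClasses_iff b p N x).1 hxD
  obtain ⟨tc, htc, ht⟩ := hcov x hxp
  have hc := hchk tc htc
  simp only [Bool.and_eq_true, Bool.or_eq_true, Bool.not_eq_true', Bool.and_eq_false_iff, decide_eq_false_iff_not,
    decide_eq_true_eq] at hc
  rw [ht.key_eq]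
  rcases hc.2 with (h | h) | h
  · exact absurd (by rw [ht.classExp_eq] at hE; exact hE) h
  · exfalso
    apply hnot
    have hc' := ht.cen_iff
    have hlv := ht.levelVec_eq
    simp only [liveL, Bool.not_and, Bool.not_not, Bool.or_eq_false_iff, Bool.not_eq_false', beq_iff_eq,
      decide_eq_true_eq] at h
    obtain ⟨⟨h1, h2⟩, h3⟩ := h
    refine ⟨fun hcen => ?_, h2, by rw [hlv]; exact h3⟩
    rw [hc'.1 hcen] at h1
    exact Bool.noConfusion h1
  · exact h

/-- **The line of the collinearity criterion from a cover** (`N` odd, moment range): whichever of the two keys are realised by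
live deep classes, the deep orbit vectors lie on a line (affine, or through the origin). -/
theorem collinear_of_cover {b : ℕ → ℤ} (hb : InPolytope b) (hpr : p.Prime) (hp5 : 5 ≤ p) (hpb : (p : ℤ) ≤ b 0)
    (hwin : (b 0 + 2 : ℤ) < (p : ℤ) ^ 2) {TY : List (List ℤ × Bool)} (hcov : Cover b p TY) {N : ℕ} (hodd : N % 2 = 1)
    (hrange : ((N : ℤ) - 1) * p + 2 ≤ 2 * dOf b + 3) {K₁ K₂ : Bool × List ℤ}
    (hchk : checkO (decide (¬ (2 : ℤ) ∣ b 0)) TY N K₁ K₂ = true) :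
    ∃ a c e : ℤ, ¬ ((p : ℤ) ∣ a ∧ (p : ℤ) ∣ c) ∧ (e = 0 ∨ ((N : ℤ) - 1) * p + 2 ≤ 2 * dOf b + 3) ∧
      ∀ x ∈ deepClasses b p N, pCong p (a * orbitK b p N x + c * orbitV b p N x + e) = true := by
  haveI : Fact p.Prime := ⟨hpr⟩
  have hkeys := fun x hx => live_key_of_cover hcov hchk (x := x) hx
  by_cases h1 : ∃ x₁ ∈ ccLive b p N, sameKey (decide (CentreIn b p x₁), levelVec b p x₁) K₁ = true
  · by_cases h2 : ∃ x₂ ∈ ccLive b p N, sameKey (decide (CentreIn b p x₂), levelVec b p x₂) K₂ = true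
    · obtain ⟨x₁, hx₁, hk₁⟩ := h1
      obtain ⟨x₂, hx₂, hk₂⟩ := h2
      obtain ⟨a, c, e, hac, h⟩ := line_affine_of_reps b hb hp5 hpb hwin hodd hx₁ hx₂ (fun x hx => by
        rcases hkeys x hx with h | h
        · exact Or.inl (sameKey_trans h (sameKey_symm hk₁))
        · exact Or.inr (sameKey_trans h (sameKey_symm hk₂)))
      exact ⟨a, c, e, hac, Or.inr hrange, h⟩
    · -- only `K₁` realised: all live keys related
      push Not at h2
      obtain ⟨a, c, hac, h⟩ := line_origin_of_related b hb hp5 hpb hwin (N := N) (fun x hx y hy => by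
        rcases hkeys x hx with hxk | hxk
        · rcases hkeys y hy with hyk | hyk
          · exact sameKey_trans hyk (sameKey_symm hxk)
          · exact absurd hyk (h2 y hy)
        · exact absurd hxk (h2 x hx))
      exact ⟨a, c, 0, hac, Or.inl rfl, fun x hx => by simpa using h x hx⟩
  · push Not at h1
    obtain ⟨a, c, hac, h⟩ := line_origin_of_related b hb hp5 hpb hwin (N := N) (fun x hx y hy => by
      rcases hkeys x hx with hxk | hxk
      · exact absurd hxk (h1 x hx)
      · rcases hkeys y hy with hyk | hyk
        · exact absurd hyk (h1 y hy)
        · exact sameKey_trans hyk (sameKey_symm hxk))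
    exact ⟨a, c, 0, hac, Or.inl rfl, fun x hx => by simpa using h x hx⟩

/-- **The COLLINEARITY RUNG from a cover**: `casLB b p + 1 ≤ v_p(Cas_j(b))` (`N ≥ 3` odd, moment range, `−N` realised). -/
theorem rungO_of_cover {b : ℕ → ℤ} {j : ℕ} (hb : InPolytope b) (hj1 : 1 ≤ j) (hj7 : j ≤ 7) (hb' : InPolytope (shift b j))
    (hpr : p.Prime) (hp5 : 5 ≤ p) (hpb : (p : ℤ) ≤ b 0) (hpd : (p : ℤ) ≤ dOf b) (hwin : (b 0 + 2 : ℤ) < (p : ℤ) ^ 2)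
    {TY : List (List ℤ × Bool)} (hcov : Cover b p TY) {N : ℕ} (hN : 3 ≤ N) (hodd : N % 2 = 1)
    (hrange : ((N : ℤ) - 1) * p + 2 ≤ 2 * dOf b + 3) {K₁ K₂ : Bool × List ℤ}
    (hchk : checkO (decide (¬ (2 : ℤ) ∣ b 0)) TY N K₁ K₂ = true)
    (hreal : ∃ x, x < p ∧ 2 ≤ classPoleCount b p x ∧ classExp b p x = -(N : ℤ)) (hcas : casoratian b j ≠ 0) :
    casLB b p + 1 ≤ padicValRat p (casoratian b j) := by
  haveI : Fact p.Prime := ⟨hpr⟩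
  have hH0 : ∀ x, x < p → -(N : ℤ) ≤ classExp b p x := by
    intro x hx
    obtain ⟨tc, htc, ht⟩ := hcov x hx
    have hc := List.all_eq_true.1 (by rw [checkO] at hchk; exact hchk) tc htc
    simp only [Bool.and_eq_true, decide_eq_true_eq] at hc
    rw [ht.classExp_eq]; exact hc.1
  obtain ⟨x, hx, h2, hE⟩ := hreal
  exact collinearityCriterion_holds b p j N hb hb' hj1 hj7 hpr hp5 hpb hpd hwin hN hH0
    ⟨x, (mem_multipoleClasses_iff b p x).2 ⟨hx, h2⟩, hE⟩ (collinear_of_cover hb hpr hp5 hpb hwin hcov hodd hrange hchk) hcas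

/-! ## §3 The record-ray wrapper -/

/-- **RECORD WINDOW BOUND by the COLLINEARITY RUNG**: `c ≤ v_p(Cas₇(b(n)))` from a cover, `checkLB` at `(−N, B)` with
`c ≤ −N + B + 1`, `checkO` at `N` (`N ≥ 3` odd, moment range `(N − 1)p ≤ 50n + 1`), and the fallback `checkLBx`. -/
theorem record_O {n : ℕ} (hn : 1 ≤ n) (hpr : p.Prime) (hp5 : 5 ≤ p) (hpd : p ≤ 25 * n) (hsq : 41 * n + 2 < p ^ 2)
    {r : ℕ} (hr : n % 2 = r) {TY : List (List ℤ × Bool)} (hcov : Cover (bRec n) p TY) {N : ℕ} (hN : 3 ≤ N)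
    (hodd : N % 2 = 1) (hrange : (N - 1) * p ≤ 50 * n + 1) {K₁ K₂ : Bool × List ℤ} {B A' B' c : ℤ}
    (hLB : checkLB (decide (r = 1)) TY (-(N : ℤ)) B = true) (hB1 : B ≤ 1)
    (hO : checkO (decide (r = 1)) TY N K₁ K₂ = true)
    (hLBx : checkLBx (decide (r = 1)) TY (-(N : ℤ)) A' B' = true) (hB1' : B' ≤ 1)
    (hc : c ≤ -(N : ℤ) + B + 1) (hc' : c ≤ A' + B') (hc0 : c ≤ 0)
    (hne : casoratian (bRec n) 7 ≠ 0) : c ≤ padicValRat p (casoratian (bRec n) 7) := by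
  haveI : Fact p.Prime := ⟨hpr⟩
  obtain ⟨hpb, hpd', hwin⟩ := rec_window (n := n) hpd hsq
  have hv := rec_LB hn hpr hp5 hpd hsq hne
  have hrange' : ((N : ℤ) - 1) * p + 2 ≤ 2 * dOf (bRec n) + 3 := by
    rw [dOf_bRec]
    have h1 : 1 ≤ N := by omega
    have : (((N - 1 : ℕ) : ℤ)) = (N : ℤ) - 1 := by omega
    have h2 : (((N - 1) * p : ℕ) : ℤ) ≤ 50 * n + 1 := by exact_mod_cast hrange
    push_cast at h2
    nlinarith
  by_cases hreal : ∃ x, x < p ∧ 2 ≤ classPoleCount (bRec n) p x ∧ classExp (bRec n) p x = -(N : ℤ)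
  · have hO' := rungO_of_cover (inPolytope_bRec n) (by norm_num) (by norm_num) (inPolytope_shift_bRec n 7 hn (by norm_num)
      (by norm_num)) hpr hp5 hpb hpd' hwin hcov hN hodd hrange' (by rw [oddFlag_bRec n hr]; exact hO) hreal hne
    rcases casLB_ge_of_cover hcov (by rw [oddFlag_bRec n hr]; exact hLB) hB1 hpd' with h0 | h
    · rw [h0] at hv; exact le_trans (by exact_mod_cast hc0) hv
    · linarith
  · rcases casLB_ge_of_cover_x hcov (by rw [oddFlag_bRec n hr]; exact hLBx) hB1' hpd' hreal with h0 | h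
    · rw [h0] at hv; exact le_trans (by exact_mod_cast hc0) hv
    · linarith

end Summit.KontsevichZagierPeriods.Zeta5Search.ClassTypeCover
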